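import Mathlib.Algebra.Order.Field.Basic
import Mathlib.Tactic.Ring
import Mathlib.Tactic.Linarith
import Mathlib.Tactic.LinearCombination
import Mathlib.Tactic.FieldSimp
import Mathlib.Tactic.Positivity
import Summits.Ventures.CertifiedArithmetic.LowPrec.SRRecursion
import Summits.Ventures.CertifiedArithmetic.LowPrec.SRDoubleRounding
import Summits.Ventures.CertifiedArithmetic.LowPrec.SRSpacing
import Summits.Ventures.CertifiedArithmetic.LowPrec.SRCertificatesFP4
import HarnessLib

/-!
# Stochastic rounding into a finite format: affine RECURSIONS, IV — the SR moving average of a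
# constant never saturates, is pathwise confined, and is ABSORBED at a representable target at
# geometric rate exactly `β`

HONEST FRAMING: certified error envelopes and provably optimal rounding/accumulation schemes for
low-precision formats under stated cost models; every table by two implementations; no hardware or
vendor claims.

File 4 on recursions `xₖ₊₁ = SR_F(a k · xₖ + b k)`, here the EMA / momentum buffer of a constant
signal `μ` (`a ≡ β`, `b ≡ (1 − β)μ`; `β = 1` and `μ = 0` is pure decay `x ← SR(βx)`), over an
ARBITRARY finite `F` in a linear ordered field:

* `inHull_conv`, `ema_noSatR` — for `μ` and `x₀` in the hull and `0 ≤ β ≤ 1` NO BRANCH EVER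
  SATURATES (every pre-rounding value is a convex combination of hull points); hence
  `recExp_ema_const_of_inHull`: `E[xₙ] = μ + βⁿ(x₀ − μ)` with no path hypothesis at all (file I's
  `recExp_ema_const` took `NoSatR` as a hypothesis);
* `step_mono_on`, `recExp_mono_on` — monotonicity of the expectation operator under a comparison
  of test functions that holds only ON THE REACHABLE STATES (a `PreAll` statement on candidates);
* `ema_states_ge` / `ema_states_le` — for a REPRESENTABLE target `μ ∈ F` the chain started at
  `x₀ ∈ F`, `x₀ ≥ μ` stays in `F ∩ [μ, ∞)` on every branch (dually below): it never crosses `μ`;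
* `ema_cell_law_of_mem_Icc` — the cell law of file III for a CLOSED cell: any `c` with
  `d = ⌊c⌋ < u = ⌈c⌉` and `μ ∈ [d, u]` (endpoints allowed), start `x₀ ∈ {d, u}`:
  `E f(xₙ) = f d + (p + βⁿ(t₀ − p))(f u − f d)`, `p = (μ − d)/(u − d)`;
* `ema_absorb_law`, `ema_absorb_prob` — `μ = d` REPRESENTABLE, start at the upper neighbour `u`:
  `E f(xₙ) = f μ + βⁿ(f u − f μ)`, i.e. `P(xₙ ≠ μ) = βⁿ` EXACTLY — the absorption time at the
  target is Geometric(1 − β), format-free, spacing-free;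
* `ema_absorb_markov` (from anywhere above) / `ema_absorb_markov_below`: for `x₀ ∈ F`, `x₀ ≥ μ`,
  `P(xₙ ≠ μ) ≤ βⁿ·(x₀ − μ)/(u − μ)` with `u` the grid successor of `μ` (Markov on the exact mean
  over the confined states);
* FP4 kernel witnesses (namespace `FP4`): E2M1, `β = 3/4`, `μ = 3/2`: from `x₀ = 2`,
  `P(x₃ ≠ 3/2) = 27/64 = (3/4)³`; from `x₀ = 3` (where round-to-nearest is stuck for ever, file
  III `e2m1_ema_rn_stuck`), `P(x₆ ≠ 3/2) = 54359/131072 ≈ 0.415 ≤ (3/4)⁶·3 = 2187/4096`; pure decay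
  `x ← SR(3/4·x)` from the smallest subnormal `1/2` reaches `0` with `P(x₃ ≠ 0) = 27/64`, whereas
  `RN(3/8) = 1/2` is stuck under every tie rule (`e2m1_decay_rn_stuck`).

The contrast in one line: round-to-nearest recursions have a dead band (file III: the estimate can
stay wrong by a relative `113` in E3M2); the stochastically rounded recursion of a representable
constant is absorbed AT the constant, almost surely, at geometric rate exactly `β`.

References: \cite{ConnollyHighamMary2021} (Lemma 4.4/4.5: one-step mean, mean independence);
\cite{Jackson1996} (§11.5: the fixed-point dead band); \cite{KieburtzLawrenceMina1977} (randomised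
quantisation against limit cycles); \cite{CrociGiles2022} (Lemma 3.5: RtN stagnation vs SR, model
arithmetic); \cite{OzkaraYuPark2025} (SR weight updates as random walks).
-/

namespace Summit.Ventures.CertifiedArithmetic.LowPrec.SR

open Finset

section Generic

variable {K : Type*} [Field K] [LinearOrder K] [IsStrictOrderedRing K]

/-! ### The SR-EMA of a constant never saturates -/

/-- The hull is convex: `β x + (1 − β) y` lies in it for `x, y` in it and `0 ≤ β ≤ 1`. -/
theorem inHull_conv {F : Finset K} {x y β : K} (hx : InHull F x) (hy : InHull F y) (hβ0 : 0 ≤ β)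
    (hβ1 : β ≤ 1) : InHull F (β * x + (1 - β) * y) := by
  obtain ⟨⟨a, ha, hax⟩, ⟨b, hb, hxb⟩⟩ := hx
  obtain ⟨⟨a', ha', hay⟩, ⟨b', hb', hyb⟩⟩ := hy
  refine ⟨⟨min a a', ?_, ?_⟩, ⟨max b b', ?_, ?_⟩⟩
  · rcases min_choice a a' with h | h <;> rw [h] <;> assumption
  · nlinarith [min_le_left a a', min_le_right a a', mul_nonneg hβ0 (sub_nonneg.2 hax),
      mul_nonneg (sub_nonneg.2 hβ1) (sub_nonneg.2 hay)]
  · rcases max_choice b b' with h | h <;> rw [h] <;> assumption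
  · nlinarith [le_max_left b b', le_max_right b b', mul_nonneg hβ0 (sub_nonneg.2 hxb),
      mul_nonneg (sub_nonneg.2 hβ1) (sub_nonneg.2 hyb)]

/-- **The SR-EMA of a constant never saturates**: for `μ` and the start in the hull and
`0 ≤ β ≤ 1`, every pre-rounding value on every branch lies in the hull (`NoSatR`), for every `n`. -/
theorem ema_noSatR {F : Finset K} {μ β : K} (hμ : InHull F μ) (hβ0 : 0 ≤ β) (hβ1 : β ≤ 1) :
    ∀ (n : ℕ) {s : K}, InHull F s → NoSatR F (affMap (fun _ => β) (fun _ => (1 - β) * μ)) n s := by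
  have hF : F.Nonempty := by obtain ⟨⟨z, hz, -⟩, -⟩ := hμ; exact ⟨z, hz⟩
  intro n
  induction n with
  | zero => intro s _; trivial
  | succ n ih =>
      intro s hs
      refine ⟨?_, ?_, ?_⟩
      · simpa only [affMap_apply] using inHull_conv hs hμ hβ0 hβ1
      · have hu := up_mem hF (affMap (fun _ => β) (fun _ => (1 - β) * μ) 0 s)
        have h := ih (s := up F _) ⟨⟨_, hu, le_rfl⟩, ⟨_, hu, le_rfl⟩⟩
        simpa only [NoSatR, affMap_succ] using h
      · have hd := dn_mem hF (affMap (fun _ => β) (fun _ => (1 - β) * μ) 0 s)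
        have h := ih (s := dn F _) ⟨⟨_, hd, le_rfl⟩, ⟨_, hd, le_rfl⟩⟩
        simpa only [NoSatR, affMap_succ] using h

/-- **Exact relaxation of the mean, no path hypothesis**: `E[xₙ] = μ + βⁿ(x₀ − μ)` for `μ`, `x₀` in
the hull and `0 ≤ β ≤ 1` (file I's `recExp_ema_const` with its `NoSatR` hypothesis discharged by
`ema_noSatR`). -/
theorem recExp_ema_const_of_inHull {F : Finset K} {μ β s : K} (hμ : InHull F μ) (hs : InHull F s)
    (hβ0 : 0 ≤ β) (hβ1 : β ≤ 1) (n : ℕ) :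
    recExp F (affMap (fun _ => β) fun _ => (1 - β) * μ) n (fun t => t) s = μ + β ^ n * (s - μ) :=
  recExp_ema_const F β μ n s (ema_noSatR hμ hβ0 hβ1 n hs)

/-! ### Monotonicity on the reachable states -/

/-- One-step monotonicity needs the comparison only at the two candidates. -/
theorem step_mono_on (F : Finset K) (c : K) {f g : K → K} (hu : f (up F c) ≤ g (up F c))
    (hd : f (dn F c) ≤ g (dn F c)) : step F c f ≤ step F c g := by
  unfold step
  have hp := pUp_nonneg F c
  have hq : 0 ≤ 1 - pUp F c := sub_nonneg.mpr (pUp_le_one F c)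
  exact add_le_add (mul_le_mul_of_nonneg_left hu hp) (mul_le_mul_of_nonneg_left hd hq)

/-- **Monotonicity on the reachable states**: if `f ≤ h` on a set of states `P` containing the start
and both candidates of every pre-rounding value on every branch, then `E f(xₙ) ≤ E h(xₙ)`. -/
theorem recExp_mono_on (F : Finset K) (P : K → Prop) {f h : K → K} (hfh : ∀ t, P t → f t ≤ h t) :
    ∀ (n : ℕ) (g : ℕ → K → K) (s : K), P s →
      PreAll F g n (fun c => P (up F c) ∧ P (dn F c)) s → recExp F g n f s ≤ recExp F g n h s := by
  intro n
  induction n with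
  | zero => intro g s hs _; exact hfh s hs
  | succ n ih =>
      intro g s _ hall
      obtain ⟨⟨hu, hd⟩, hU, hD⟩ := hall
      simp only [recExp]
      exact step_mono_on F _ (ih _ _ hu hU) (ih _ _ hd hD)

/-- Equality version: test functions that agree on the reachable states have equal expectations. -/
theorem recExp_congr_on (F : Finset K) (P : K → Prop) {f h : K → K} (hfh : ∀ t, P t → f t = h t)
    (n : ℕ) (g : ℕ → K → K) (s : K) (hs : P s)
    (hall : PreAll F g n (fun c => P (up F c) ∧ P (dn F c)) s) :
    recExp F g n f s = recExp F g n h s :=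
  le_antisymm (recExp_mono_on F P (fun t ht => (hfh t ht).le) n g s hs hall)
    (recExp_mono_on F P (fun t ht => (hfh t ht).ge) n g s hs hall)

omit [IsStrictOrderedRing K] in
/-- Expectation of an affine test function. -/
theorem recExp_linear_test (F : Finset K) (g : ℕ → K → K) (n : ℕ) (A B s : K) :
    recExp F g n (fun t => A * t + B) s = A * recExp F g n (fun t => t) s + B := by
  rw [recExp_add F g n (fun t => A * t) (fun _ => B), recExp_mul_left, recExp_const]

/-! ### Confinement: the chain never crosses a representable target -/

omit [Field K] [IsStrictOrderedRing K] in
/-- In a finite grid a member strictly above `⌊c⌋` is at least `⌈c⌉`: nothing of `F` lies strictly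
inside a cell. -/
theorem up_le_of_dn_lt {F : Finset K} {c f : K} (hf : f ∈ F) (h : dn F c < f) : up F c ≤ f := by
  rcases le_total f c with hfc | hcf
  · exact absurd (le_dn_of_mem hf hfc) (not_le.2 h)
  · exact up_le_of_mem hf hcf

omit [Field K] [IsStrictOrderedRing K] in
/-- Dually, a member strictly below `⌈c⌉` is at most `⌊c⌋`. -/
theorem le_dn_of_lt_up {F : Finset K} {c f : K} (hf : f ∈ F) (h : f < up F c) : f ≤ dn F c := by
  rcases le_total f c with hfc | hcf
  · exact le_dn_of_mem hf hfc
  · exact absurd (up_le_of_mem hf hcf) (not_le.2 h)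

/-- **Confinement above a representable target**: `μ ∈ F`, `0 ≤ β`, start `x₀ ∈ F` with
`x₀ ≥ μ`: both candidates of every pre-rounding value on every branch are members of `F` that are
`≥ μ` — the SR-EMA never crosses `μ` (and never leaves the grid). -/
theorem ema_states_ge {F : Finset K} {μ β : K} (hμF : μ ∈ F) (hβ0 : 0 ≤ β) :
    ∀ (n : ℕ) {s : K}, s ∈ F → μ ≤ s →
      PreAll F (affMap (fun _ => β) (fun _ => (1 - β) * μ)) n
        (fun c => (up F c ∈ F ∧ μ ≤ up F c) ∧ (dn F c ∈ F ∧ μ ≤ dn F c)) s := by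
  have hF : F.Nonempty := ⟨μ, hμF⟩
  intro n
  induction n with
  | zero => intro s _ _; trivial
  | succ n ih =>
      intro s hs hμs
      have hc : μ ≤ β * s + (1 - β) * μ := by nlinarith [mul_nonneg hβ0 (sub_nonneg.2 hμs)]
      have hd : μ ≤ dn F (β * s + (1 - β) * μ) := le_dn_of_mem hμF hc
      have hu : μ ≤ up F (β * s + (1 - β) * μ) :=
        hd.trans ((dn_le_clamp F _).trans (clamp_le_up F _))
      refine ⟨⟨⟨up_mem hF _, hu⟩, ⟨dn_mem hF _, hd⟩⟩, ?_, ?_⟩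
      · simpa only [affMap_succ, affMap_apply] using ih (up_mem hF _) hu
      · simpa only [affMap_succ, affMap_apply] using ih (dn_mem hF _) hd

/-- **Confinement below a representable target** (mirror image). -/
theorem ema_states_le {F : Finset K} {μ β : K} (hμF : μ ∈ F) (hβ0 : 0 ≤ β) :
    ∀ (n : ℕ) {s : K}, s ∈ F → s ≤ μ →
      PreAll F (affMap (fun _ => β) (fun _ => (1 - β) * μ)) n
        (fun c => (up F c ∈ F ∧ up F c ≤ μ) ∧ (dn F c ∈ F ∧ dn F c ≤ μ)) s := by
  have hF : F.Nonempty := ⟨μ, hμF⟩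
  intro n
  induction n with
  | zero => intro s _ _; trivial
  | succ n ih =>
      intro s hs hsμ
      have hc : β * s + (1 - β) * μ ≤ μ := by nlinarith [mul_nonneg hβ0 (sub_nonneg.2 hsμ)]
      have hu : up F (β * s + (1 - β) * μ) ≤ μ := up_le_of_mem hμF hc
      have hd : dn F (β * s + (1 - β) * μ) ≤ μ :=
        ((dn_le_clamp F _).trans (clamp_le_up F _)).trans hu
      refine ⟨⟨⟨up_mem hF _, hu⟩, ⟨dn_mem hF _, hd⟩⟩, ?_, ?_⟩
      · simpa only [affMap_succ, affMap_apply] using ih (up_mem hF _) hu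
      · simpa only [affMap_succ, affMap_apply] using ih (dn_mem hF _) hd

/-! ### Absorption at a representable target: Markov form, from anywhere -/

/-- **Absorption, Markov form (from above)**: let `μ = ⌊c⌋ < u = ⌈c⌉` (so `μ ∈ F` and `u` is its
grid successor), `x₀ ∈ F`, `x₀ ≥ μ`, `0 ≤ β ≤ 1`. Then `P(xₙ ≠ μ) ≤ βⁿ·(x₀ − μ)/(u − μ)`: the
SR-EMA is absorbed AT the target, geometrically fast, from every start — where round-to-nearest has
a dead band (file III). Proof: Markov on the exact mean `μ + βⁿ(x₀ − μ)` over the confined states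
(a state `≠ μ` is `≥ u`). -/
theorem ema_absorb_markov {F : Finset K} {μ β c s : K} (hdn : dn F c = μ) (hcell : μ < up F c)
    (hs : s ∈ F) (hμs : μ ≤ s) (hβ0 : 0 ≤ β) (hβ1 : β ≤ 1) (n : ℕ) :
    recExp F (affMap (fun _ => β) fun _ => (1 - β) * μ) n (fun v => if v = μ then 0 else 1) s
      ≤ β ^ n * (s - μ) / (up F c - μ) := by
  have hF : F.Nonempty := ⟨s, hs⟩
  have hμF : μ ∈ F := hdn ▸ dn_mem hF c
  have hpos : 0 < up F c - μ := sub_pos.2 hcell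
  have hcmp : ∀ t, (t ∈ F ∧ μ ≤ t) → (if t = μ then (0 : K) else 1) ≤ (t - μ) / (up F c - μ) := by
    rintro t ⟨htF, hμt⟩
    by_cases htμ : t = μ
    · rw [if_pos htμ, htμ, sub_self, zero_div]
    · rw [if_neg htμ]
      have hlt : dn F c < t := hdn ▸ lt_of_le_of_ne hμt (Ne.symm htμ)
      have hut : up F c ≤ t := up_le_of_dn_lt htF hlt
      rw [le_div_iff₀ hpos, one_mul]
      linarith
  have h1 := recExp_mono_on F (fun t => t ∈ F ∧ μ ≤ t) hcmp n
    (affMap (fun _ => β) fun _ => (1 - β) * μ) s ⟨hs, hμs⟩ (ema_states_ge hμF hβ0 n hs hμs)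
  have h2 : recExp F (affMap (fun _ => β) fun _ => (1 - β) * μ) n
      (fun t => (t - μ) / (up F c - μ)) s = β ^ n * (s - μ) / (up F c - μ) := by
    have e : (fun t : K => (t - μ) / (up F c - μ))
        = fun t => (1 / (up F c - μ)) * t + (-μ / (up F c - μ)) := by
      funext t; ring
    rw [e, recExp_linear_test, recExp_ema_const_of_inHull (μ := μ) (s := s)
      ⟨⟨μ, hμF, le_rfl⟩, ⟨μ, hμF, le_rfl⟩⟩ ⟨⟨s, hs, le_rfl⟩, ⟨s, hs, le_rfl⟩⟩ hβ0 hβ1 n]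
    field_simp
    ring
  exact h1.trans h2.le

/-- **Absorption, Markov form (from below)**: `d = ⌊c⌋ < μ = ⌈c⌉`, `x₀ ∈ F`, `x₀ ≤ μ`:
`P(xₙ ≠ μ) ≤ βⁿ·(μ − x₀)/(μ − d)`. -/
theorem ema_absorb_markov_below {F : Finset K} {μ β c s : K} (hup : up F c = μ)
    (hcell : dn F c < μ) (hs : s ∈ F) (hsμ : s ≤ μ) (hβ0 : 0 ≤ β) (hβ1 : β ≤ 1) (n : ℕ) :
    recExp F (affMap (fun _ => β) fun _ => (1 - β) * μ) n (fun v => if v = μ then 0 else 1) s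
      ≤ β ^ n * (μ - s) / (μ - dn F c) := by
  have hF : F.Nonempty := ⟨s, hs⟩
  have hμF : μ ∈ F := hup ▸ up_mem hF c
  have hpos : 0 < μ - dn F c := sub_pos.2 hcell
  have hcmp : ∀ t, (t ∈ F ∧ t ≤ μ) → (if t = μ then (0 : K) else 1) ≤ (μ - t) / (μ - dn F c) := by
    rintro t ⟨htF, htμ'⟩
    by_cases htμ : t = μ
    · rw [if_pos htμ, htμ, sub_self, zero_div]
    · rw [if_neg htμ]
      have hlt : t < up F c := hup ▸ lt_of_le_of_ne htμ' htμ
      have htd : t ≤ dn F c := le_dn_of_lt_up htF hlt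
      rw [le_div_iff₀ hpos, one_mul]
      linarith
  have h1 := recExp_mono_on F (fun t => t ∈ F ∧ t ≤ μ) hcmp n
    (affMap (fun _ => β) fun _ => (1 - β) * μ) s ⟨hs, hsμ⟩ (ema_states_le hμF hβ0 n hs hsμ)
  have h2 : recExp F (affMap (fun _ => β) fun _ => (1 - β) * μ) n
      (fun t => (μ - t) / (μ - dn F c)) s = β ^ n * (μ - s) / (μ - dn F c) := by
    have e : (fun t : K => (μ - t) / (μ - dn F c))
        = fun t => (-1 / (μ - dn F c)) * t + (μ / (μ - dn F c)) := by
      funext t; ring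
    rw [e, recExp_linear_test, recExp_ema_const_of_inHull (μ := μ) (s := s)
      ⟨⟨μ, hμF, le_rfl⟩, ⟨μ, hμF, le_rfl⟩⟩ ⟨⟨s, hs, le_rfl⟩, ⟨s, hs, le_rfl⟩⟩ hβ0 hβ1 n]
    field_simp
    ring
  exact h1.trans h2.le

/-! ### The closed-cell law and the exact absorption law from the neighbour -/

/-- **Cell law, closed cell**: any `c` in the hull with a nondegenerate cell `d = ⌊c⌋ < u = ⌈c⌉`,
a target `μ ∈ [d, u]` (ENDPOINTS ALLOWED — `μ` may be representable), `0 ≤ β ≤ 1`, start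
`x₀ ∈ {d, u}`, `t₀ = 1[x₀ = u]`, `p = (μ − d)/(u − d)`: for every test function,
`E f(xₙ) = f d + (p + βⁿ(t₀ − p))·(f u − f d)` (file III's `ema_cell_law` is the case `c = μ ∉ F`). -/
theorem ema_cell_law_of_mem_Icc {F : Finset K} {c μ : K} (hc : InHull F c) (hcell : dn F c < up F c)
    (hμd : dn F c ≤ μ) (hμu : μ ≤ up F c) {β : K} (hβ0 : 0 ≤ β) (hβ1 : β ≤ 1) (f : K → K) (n : ℕ)
    {y : K} (hy : y = dn F c ∨ y = up F c) :
    recExp F (affMap (fun _ => β) (fun _ => (1 - β) * μ)) n f y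
      = f (dn F c) + ((μ - dn F c) / (up F c - dn F c)
          + β ^ n * ((y - dn F c) / (up F c - dn F c) - (μ - dn F c) / (up F c - dn F c)))
          * (f (up F c) - f (dn F c)) := by
  have hne : up F c - dn F c ≠ 0 := sub_ne_zero.mpr (ne_of_gt hcell)
  induction n generalizing y with
  | zero =>
    rcases hy with rfl | rfl
    · simp only [recExp, pow_zero, one_mul, sub_self, zero_div]; ring
    · simp only [recExp, pow_zero, one_mul, div_self hne]; ring
  | succ n ih =>
    have hyd : dn F c ≤ y := by rcases hy with rfl | rfl; exacts [le_rfl, hcell.le]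
    have hyu : y ≤ up F c := by rcases hy with rfl | rfl; exacts [hcell.le, le_rfl]
    have h1 : dn F c ≤ β * y + (1 - β) * μ := by
      nlinarith [mul_nonneg hβ0 (sub_nonneg.2 hyd), mul_nonneg (sub_nonneg.2 hβ1) (sub_nonneg.2 hμd)]
    have h2 : β * y + (1 - β) * μ ≤ up F c := by
      nlinarith [mul_nonneg hβ0 (sub_nonneg.2 hyu), mul_nonneg (sub_nonneg.2 hβ1) (sub_nonneg.2 hμu)]
    simp only [recExp, affMap_succ, affMap_apply]
    rw [step_eq_affine hc h1 h2, ih (Or.inl rfl), ih (Or.inr rfl)]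
    simp only [sub_self, zero_div, div_self hne, pow_succ]
    field_simp
    ring

/-- **Exact absorption law at a representable target, from its upper neighbour**: `μ = ⌊c⌋ ∈ F`,
`u = ⌈c⌉ > μ`, start `u`: `E f(xₙ) = f μ + βⁿ·(f u − f μ)` — the chain sits at `u` until a
Geometric(1 − β) time and then at `μ` for ever; format-free, spacing-free. -/
theorem ema_absorb_law {F : Finset K} {c : K} (hc : InHull F c) (hcell : dn F c < up F c) {β : K}
    (hβ0 : 0 ≤ β) (hβ1 : β ≤ 1) (f : K → K) (n : ℕ) :
    recExp F (affMap (fun _ => β) (fun _ => (1 - β) * dn F c)) n f (up F c)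
      = f (dn F c) + β ^ n * (f (up F c) - f (dn F c)) := by
  have hne : up F c - dn F c ≠ 0 := sub_ne_zero.mpr (ne_of_gt hcell)
  rw [ema_cell_law_of_mem_Icc hc hcell le_rfl hcell.le hβ0 hβ1 f n (Or.inr rfl)]
  simp only [sub_self, zero_div, div_self hne]
  ring

/-- `P(xₙ ≠ μ) = βⁿ` exactly from the upper neighbour (`P(T > n) = βⁿ`: the absorption time `T`
is Geometric(1 − β), mean `1/(1 − β)`). -/
theorem ema_absorb_prob {F : Finset K} {c : K} (hc : InHull F c) (hcell : dn F c < up F c) {β : K}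
    (hβ0 : 0 ≤ β) (hβ1 : β ≤ 1) (n : ℕ) :
    recExp F (affMap (fun _ => β) (fun _ => (1 - β) * dn F c)) n
        (fun v => if v = dn F c then 0 else 1) (up F c) = β ^ n := by
  rw [ema_absorb_law hc hcell hβ0 hβ1 _ n, if_pos rfl, if_neg (ne_of_gt hcell)]
  ring

/-- Mirror image: target `μ = ⌈c⌉ ∈ F`, start at the lower neighbour `d = ⌊c⌋`:
`E f(xₙ) = f μ + βⁿ·(f d − f μ)`. -/
theorem ema_absorb_law_below {F : Finset K} {c : K} (hc : InHull F c) (hcell : dn F c < up F c)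
    {β : K} (hβ0 : 0 ≤ β) (hβ1 : β ≤ 1) (f : K → K) (n : ℕ) :
    recExp F (affMap (fun _ => β) (fun _ => (1 - β) * up F c)) n f (dn F c)
      = f (up F c) + β ^ n * (f (dn F c) - f (up F c)) := by
  have hne : up F c - dn F c ≠ 0 := sub_ne_zero.mpr (ne_of_gt hcell)
  rw [ema_cell_law_of_mem_Icc hc hcell hcell.le le_rfl hβ0 hβ1 f n (Or.inl rfl)]
  simp only [sub_self, zero_div, div_self hne]
  ring

end Generic

/-! ### FP4 (E2M1) kernel witnesses -/

namespace FP4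

/-- The cell of `7/4` in E2M1 is `[3/2, 2]`. -/
theorem e2m1_cell_seven_quarters :
    InHull e2m1 (7/4 : ℚ) ∧ dn e2m1 (7/4 : ℚ) = 3/2 ∧ up e2m1 (7/4 : ℚ) = 2 := by
  decide +kernel

/-- SR-EMA `β = 3/4` of `μ = 3/2` from the upper neighbour `2`: `P(x₃ ≠ 3/2) = 27/64 = (3/4)³`
(kernel evaluation of the law). -/
theorem e2m1_ema_absorb3 :
    recExp e2m1 (affMap (fun _ => 3/4) (fun _ => (1 - 3/4) * (3/2))) 3
      (fun v => if v = 3/2 then 0 else 1) 2 = 27 / 64 := by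
  decide +kernel

/-- … and for EVERY `n`, `P(xₙ ≠ 3/2) = (3/4)ⁿ` (instance of `ema_absorb_prob`). -/
theorem e2m1_ema_absorb (n : ℕ) :
    recExp e2m1 (affMap (fun _ => 3/4) (fun _ => (1 - 3/4) * (3/2))) n
      (fun v => if v = 3/2 then 0 else 1) 2 = (3/4) ^ n := by
  obtain ⟨hc, hd, hu⟩ := e2m1_cell_seven_quarters
  have h := ema_absorb_prob hc (by rw [hd, hu]; norm_num) (β := 3/4) (by norm_num) (by norm_num) n
  rwa [hd, hu] at h

/-- From `x₀ = 3` — where every round-to-nearest EMA is stuck for ever (file III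
`e2m1_ema_rn_stuck`) — the SR-EMA has `P(x₆ ≠ 3/2) = 54359/131072 ≈ 0.415` (kernel), within the
Markov bound `(3/4)⁶·(3 − 3/2)/(2 − 3/2) = 2187/4096 ≈ 0.534` of `ema_absorb_markov`. -/
theorem e2m1_ema_absorb6_from3 :
    recExp e2m1 (affMap (fun _ => 3/4) (fun _ => (1 - 3/4) * (3/2))) 6
      (fun v => if v = 3/2 then 0 else 1) 3 = 54359 / 131072 ∧
    (54359 / 131072 : ℚ) ≤ (3/4) ^ 6 * (3 - 3/2) / (2 - 3/2) := by
  refine ⟨by decide +kernel, by norm_num⟩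

/-- The Markov bound itself, instantiated (every `n`, start `3`). -/
theorem e2m1_ema_absorb_markov3 (n : ℕ) :
    recExp e2m1 (affMap (fun _ => 3/4) (fun _ => (1 - 3/4) * (3/2))) n
      (fun v => if v = 3/2 then 0 else 1) 3 ≤ (3/4) ^ n * (3 - 3/2) / (2 - 3/2) := by
  obtain ⟨-, hd, hu⟩ := e2m1_cell_seven_quarters
  have h := ema_absorb_markov (F := e2m1) (β := 3/4) (s := 3) hd (by rw [hu]; norm_num)
    (by decide +kernel) (by norm_num) (by norm_num) (by norm_num) n
  rwa [hu] at h

/-- Pure decay `x ← SR(3/4·x)` in E2M1 from the smallest subnormal `1/2`: `P(x₃ ≠ 0) = 27/64`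
(absorbed AT zero at rate `3/4`) … -/
theorem e2m1_decay_absorb3 :
    recExp e2m1 (affMap (fun _ => 3/4) (fun _ => (1 - 3/4) * 0)) 3
      (fun v => if v = 0 then 0 else 1) (1/2) = 27 / 64 := by
  decide +kernel

/-- … whereas round-to-nearest decay of `1/2` is stuck under EVERY tie rule: `3/8` is strictly
nearer to `1/2` than to any other E2M1 value (the sharp hypothesis of file III's
`ema_rn_deadband`). -/
theorem e2m1_decay_rn_stuck : ∀ f ∈ e2m1, f ≠ 1/2 →
    |(3/4 : ℚ) * (1/2) + (1 - 3/4) * 0 - 1/2| < |(3/4 : ℚ) * (1/2) + (1 - 3/4) * 0 - f| := by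
  decide +kernel

end FP4

end Summit.Ventures.CertifiedArithmetic.LowPrec.SR
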